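import Mathlib
import Literature.AlgebraicGeometry.Resolution.RegularLocalRingsNormal
import HarnessLib

/-!
# Crux `Steer` (stmt-ResolutionOfSingularities-16345), chain W4.1, `stub_logFinalExitM` (E1 half):
# **L4 `stub_sandwichModel`** — the Frobenius sandwich, derivation-free

OURS (campaign `res-hironaka`, rung L, slot W4.1, chain W4.1; replaces the role of no printed item; NOT a
statement of the manuscript under review; AI review is weaker than expert review). Theses-free helper for
the E1 ("content of `d(t ^ p)` invertible") half of the registered stub `stub_logFinalExitM` of the line
`Cruxes/Steer/Lines/switching_dichotomy.lean` (holder res-L0-w41-lead-1, r19), = sub-stub **L4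
`stub_sandwichModel`** of res-L0-w41-idea-2's `PLAN-LogFinalExitM.md` §3, in the DERIVATION-FREE form fixed
by the owner of the split (res-D-pv-014 AS res-L0-w41-stub-9, STATUS 2026-08-27T04:58:27Z).

## Setting and statements (namespace `…Theorems.SwitchingDichotomy.Sandwich`)

`K` a field of characteristic `p` (prime), `S : Subring K` (in the application: the regular local ring of a
member of the point sequence, `Frac S = F`, `K = F(t)`, `t ^ p = f ∈ S`), and two further subrings given
OBJECT-FREE by their memberships:

* `B` with `x ∈ B ↔ x ∈ S ∧ ∃ c, c ^ p = x` (`B = S ∩ K^p`; in the application the joint kernel of the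
  content frame, a regular local ring by the iterated slice decomposition — stub-6's L3, stub-9's L3½);
* `C` with `x ∈ C ↔ x ^ p ∈ S` (`C = {c | c ^ p ∈ S}`; CANONICAL def-free realisation
  `S.comap (frobenius K p)`, `mem_comap_frobenius_iff`).

Hypotheses «`S` is integrally closed in `Frac S ⊆ K`» (`hSn`, elementary: an element of `K` that is a
fraction of elements of `S` and integral over `S` lies in `S`; DISCHARGED from `[IsIntegrallyClosed S]` by
`mem_of_isIntegral_of_exists_div`, and from `[IsRegularLocalRing S]` through the tree's
`isIntegrallyClosed_of_isRegularLocalRing`, Matsumura Thm. 19.4 PROVED) and «`K^p ⊆ Frac S`» (`hKp`,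
elementary: every `x ^ p` is a fraction of elements of `S`; bridge from `x ^ p ∈ Subfield.closure S` by
`exists_div_of_mem_closure`). Proved:

* `le_of_forall_mem_iff_pow_mem` — `S ≤ C`;
* `isIntegral_of_pow_mem` — `c ^ p ∈ S ⇒ c` integral over `S` (root of `X ^ p - c ^ p`);
* `pow_mem_of_isIntegral` — under `hKp`, `hSn`: `c` integral over `S ⇒ c ^ p ∈ S`;
* `mem_iff_isIntegral` — hence **`c ∈ C ↔ IsIntegral S c`**: `C` IS the integral closure of `S` in `K`
  (`toSubring_integralClosure_eq`: `(integralClosure S K).toSubring = C`);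
* `exists_ringEquiv_frobenius` — **Frobenius restricts to a ring isomorphism `e : C ≃+* B`,
  `(e c : K) = c ^ p`** (injective: Frobenius; onto: `hB`);
* `isRegularLocalRing_of_frobenius` — hence **`C` is a regular local ring when `B` is**
  (Mathlib `IsRegularLocalRing.of_ringEquiv`), and `isRegularLocalRing_integralClosure` — so is
  `integralClosure S K`;
* `closure_insert_le_comap_frobenius`, `exists_div_pow_of_forall_exists_div`,
  `exists_div_pow_of_isFractionRing_adjoin` — DISCHARGE of `hKp` when `K = Frac (S[t])`, `t ^ p ∈ S`
  (the line's `IsFractionRing (Algebra.adjoin k (insert t A₁)) K` with `A₁ ⊆ S`);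
* `sandwichModel`, `sandwichModel_of_isRegularLocalRing`, `sandwichModel_of_isFractionRing_adjoin` — the
  conclusions packaged in the split's exact shape (`hSn`/`hKp` as binders, resp. `hSn` discharged from
  `[IsRegularLocalRing S]`, resp. both discharged in the line's shape).

Elementary commutative algebra; no named facts. In print this is the "Frobenius sandwich"
`X → X/𝓕 → X^{(p)}` of a height-one purely inseparable morphism read on local rings (Ekedahl 1987 §1;
tree notions `Literature/AlgebraicGeometry/Resolution/FrobeniusSandwich.lean`), combined with normality of
regular local rings. [cite: Matsumura1987, Thm. 19.4 (regular ⇒ normal); Thm. 9.1 (integral closure)]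
[folklore]
-/

noncomputable section

-- `Summit.<S>.<S>.…` duplicates the summit name by design (single-problem summit).
set_option linter.dupNamespace false

open Polynomial

namespace Summit.ResolutionOfSingularities.ResolutionOfSingularities.Theorems.SwitchingDichotomy

namespace Sandwich

variable {K : Type*} [Field K]

/-! ## 1. Fractions of a subring and normality read inside `K` -/

section Fractions

variable (S : Subring K)

/-- Elements of the subfield generated by a subring `S ⊆ K` are fractions `a / b` of elements of `S` with
`b ≠ 0`. [folklore] -/
theorem exists_div_of_mem_closure {x : K} (hx : x ∈ Subfield.closure (S : Set K)) :
    ∃ a ∈ S, ∃ b ∈ S, b ≠ 0 ∧ x = a / b := by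
  rw [Subfield.mem_closure_iff] at hx
  obtain ⟨y, hy, z, hz, rfl⟩ := hx
  rw [Subring.closure_eq] at hy hz
  by_cases hz0 : z = 0
  · exact ⟨0, S.zero_mem, 1, S.one_mem, one_ne_zero, by rw [hz0, div_zero, zero_div]⟩
  · exact ⟨y, hy, z, hz, hz0, rfl⟩

/-- Conversely fractions of elements of `S` lie in the subfield generated by `S`. [folklore] -/
theorem div_mem_closure {a b : K} (ha : a ∈ S) (hb : b ∈ S) : a / b ∈ Subfield.closure (S : Set K) :=
  div_mem (Subfield.subset_closure ha) (Subfield.subset_closure hb)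

/-- **Normality read inside `K`.** If the ring `S` is integrally closed (in its abstract field of
fractions), then an element of `K` which is a fraction of elements of `S` and integral over `S` lies in
`S`: transport along the (injective) canonical map `Frac S → K`. [cite: Matsumura1987, §9 p. 64]
[folklore] -/
theorem mem_of_isIntegral_of_exists_div [IsIntegrallyClosed S] {x : K} (hx : IsIntegral S x)
    (hfr : ∃ a ∈ S, ∃ b ∈ S, b ≠ 0 ∧ x = a / b) : x ∈ S := by
  obtain ⟨a, ha, b, hb, hb0, rfl⟩ := hfr
  have hinj : Function.Injective (algebraMap S K) := Subtype.coe_injective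
  set L := FractionRing S with hL
  let j : L →ₐ[S] K :=
    { IsFractionRing.lift hinj with
      commutes' := fun s => IsFractionRing.lift_algebraMap hinj s }
  have hj : ∀ y : L, j y = IsFractionRing.lift hinj y := fun _ => rfl
  set z : L := algebraMap S L ⟨a, ha⟩ / algebraMap S L ⟨b, hb⟩ with hz
  have hjz : j z = a / b := by
    rw [hj, hz, map_div₀, IsFractionRing.lift_algebraMap, IsFractionRing.lift_algebraMap]
    rfl
  have hzint : IsIntegral S z := by
    rw [← isIntegral_algHom_iff j j.toRingHom.injective, hjz]
    exact hx
  obtain ⟨y, hy⟩ := IsIntegrallyClosed.algebraMap_eq_of_integral hzint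
  have hxy : (y : K) = a / b := by
    rw [← hjz, ← hy]
    exact (IsFractionRing.lift_algebraMap hinj y).symm
  rw [← hxy]
  exact y.2

/-- The same for a REGULAR LOCAL subring `S` (regular local rings are normal — Matsumura Thm. 19.4,
PROVED in the tree: `isIntegrallyClosed_of_isRegularLocalRing`). [cite: Matsumura1987, Thm. 19.4] -/
theorem mem_of_isIntegral_of_exists_div_of_isRegularLocalRing [IsRegularLocalRing S] {x : K}
    (hx : IsIntegral S x) (hfr : ∃ a ∈ S, ∃ b ∈ S, b ≠ 0 ∧ x = a / b) : x ∈ S := by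
  haveI : IsIntegrallyClosed S :=
    Literature.AlgebraicGeometry.Resolution.isIntegrallyClosed_of_isRegularLocalRing S
  exact mem_of_isIntegral_of_exists_div S hx hfr

end Fractions

/-! ## 2. The sandwich `S ≤ C = {c | c ^ p ∈ S} ≅ B = S ∩ K^p` -/

section Sandwich

variable (p : ℕ) {S : Subring K}

/-- (i) `S ≤ C`. [folklore] -/
theorem le_of_forall_mem_iff_pow_mem {C : Subring K} (hC : ∀ x, x ∈ C ↔ x ^ p ∈ S) : S ≤ C :=
  fun _ hx => (hC _).mpr (S.pow_mem hx p)

variable (S) in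
/-- Under «`K^p ⊆ Frac S`» and «`S` integrally closed in `Frac S`»: an element of `K` integral over `S`
has its `p`-th power in `S` (`c ^ p` is integral over `S` and a fraction of elements of `S`). [folklore] -/
theorem pow_mem_of_isIntegral (hKp : ∀ x : K, ∃ a ∈ S, ∃ b ∈ S, b ≠ 0 ∧ x ^ p = a / b)
    (hSn : ∀ x : K, IsIntegral S x → (∃ a ∈ S, ∃ b ∈ S, b ≠ 0 ∧ x = a / b) → x ∈ S) {c : K}
    (hc : IsIntegral S c) : c ^ p ∈ S :=
  hSn (c ^ p) (hc.pow p) (hKp c)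

variable [Fact p.Prime]

variable (S) in
/-- An element whose `p`-th power lies in `S` is integral over `S` (`p ≠ 0`). [folklore] -/
theorem isIntegral_of_pow_mem {c : K} (hc : c ^ p ∈ S) : IsIntegral S c := by
  have hp : p.Prime := Fact.out
  have h : IsIntegral S (algebraMap S K ⟨c ^ p, hc⟩) := isIntegral_algebraMap
  exact IsIntegral.of_pow hp.pos h

/-- (iii) **`C` is the integral closure of `S` in `K`**: `c ∈ C ↔ c` is integral over `S`. [folklore] -/
theorem mem_iff_isIntegral {C : Subring K} (hC : ∀ x, x ∈ C ↔ x ^ p ∈ S)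
    (hKp : ∀ x : K, ∃ a ∈ S, ∃ b ∈ S, b ≠ 0 ∧ x ^ p = a / b)
    (hSn : ∀ x : K, IsIntegral S x → (∃ a ∈ S, ∃ b ∈ S, b ≠ 0 ∧ x = a / b) → x ∈ S) (c : K) :
    c ∈ C ↔ IsIntegral S c :=
  ⟨fun h => isIntegral_of_pow_mem p S ((hC c).mp h),
    fun h => (hC c).mpr (pow_mem_of_isIntegral p S hKp hSn h)⟩

/-- (iii') The same as an equality of subrings of `K`: `(integralClosure S K).toSubring = C`. [folklore] -/
theorem toSubring_integralClosure_eq {C : Subring K} (hC : ∀ x, x ∈ C ↔ x ^ p ∈ S)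
    (hKp : ∀ x : K, ∃ a ∈ S, ∃ b ∈ S, b ≠ 0 ∧ x ^ p = a / b)
    (hSn : ∀ x : K, IsIntegral S x → (∃ a ∈ S, ∃ b ∈ S, b ≠ 0 ∧ x = a / b) → x ∈ S) :
    (integralClosure S K).toSubring = C := by
  ext c
  rw [Subalgebra.mem_toSubring, mem_integralClosure_iff, mem_iff_isIntegral p hC hKp hSn]

variable [CharP K p]

variable (S) in
/-- The canonical def-free realisation of `C = {c ∈ K | c ^ p ∈ S}`: the preimage of `S` under the
Frobenius of `K`. [folklore] -/
theorem mem_comap_frobenius_iff (x : K) : x ∈ S.comap (frobenius K p) ↔ x ^ p ∈ S := by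
  rw [Subring.mem_comap, frobenius_def]

variable (S) in
/-- The canonical def-free realisation of `B = S ∩ K^p`. [folklore] -/
theorem mem_inf_range_frobenius_iff (x : K) :
    x ∈ S ⊓ (frobenius K p).range ↔ x ∈ S ∧ ∃ c : K, c ^ p = x := by
  simp only [Subring.mem_inf, RingHom.mem_range, frobenius_def]

/-- (ii) **Frobenius restricts to a ring isomorphism `C ≃+* B`** (`c ↦ c ^ p`): it maps `C` into `B` by
the two membership descriptions, is injective because the Frobenius of a field is, and is onto `B` because
every element of `B` is a `p`-th power of an element which then lies in `C`. [folklore] -/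
theorem exists_ringEquiv_frobenius {B C : Subring K} (hB : ∀ x, x ∈ B ↔ x ∈ S ∧ ∃ c : K, c ^ p = x)
    (hC : ∀ x, x ∈ C ↔ x ^ p ∈ S) :
    ∃ e : C ≃+* B, ∀ c : C, ((e c : B) : K) = (c : K) ^ p := by
  have hmap : ∀ x ∈ C, frobenius K p x ∈ B := fun x hx =>
    (hB _).mpr ⟨by rw [frobenius_def]; exact (hC x).mp hx, x, (frobenius_def p x).symm⟩
  let f : C →+* B := (frobenius K p).restrict C B hmap
  have hf : ∀ c : C, ((f c : B) : K) = (c : K) ^ p := fun c => rfl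
  have hinj : Function.Injective f := by
    intro c₁ c₂ h
    apply Subtype.ext
    apply frobenius_inj K p
    have h' := congr_arg (fun b : B => (b : K)) h
    simp only [hf] at h'
    rw [frobenius_def, frobenius_def]
    exact h'
  have hsurj : Function.Surjective f := by
    intro b
    obtain ⟨hbS, c, hc⟩ := (hB b).mp b.2
    refine ⟨⟨c, (hC c).mpr (by rw [hc]; exact hbS)⟩, Subtype.ext ?_⟩
    rw [hf]
    exact hc
  exact ⟨RingEquiv.ofBijective f ⟨hinj, hsurj⟩, fun c => hf c⟩

/-- (ii') Hence **`C` is a regular local ring as soon as `B` is** (transport along the Frobenius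
isomorphism). [folklore] -/
theorem isRegularLocalRing_of_frobenius {B C : Subring K} (hB : ∀ x, x ∈ B ↔ x ∈ S ∧ ∃ c : K, c ^ p = x)
    (hC : ∀ x, x ∈ C ↔ x ^ p ∈ S) [IsRegularLocalRing B] : IsRegularLocalRing C := by
  obtain ⟨e, -⟩ := exists_ringEquiv_frobenius p hB hC
  exact IsRegularLocalRing.of_ringEquiv e.symm

/-- (ii'') … and then the integral closure of `S` in `K` (Mathlib's `integralClosure S K`) is a regular
local ring. [folklore] -/
theorem isRegularLocalRing_integralClosure {B : Subring K} (hB : ∀ x, x ∈ B ↔ x ∈ S ∧ ∃ c : K, c ^ p = x)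
    [IsRegularLocalRing B] (hKp : ∀ x : K, ∃ a ∈ S, ∃ b ∈ S, b ≠ 0 ∧ x ^ p = a / b)
    (hSn : ∀ x : K, IsIntegral S x → (∃ a ∈ S, ∃ b ∈ S, b ≠ 0 ∧ x = a / b) → x ∈ S) :
    IsRegularLocalRing (integralClosure S K) := by
  haveI : IsRegularLocalRing (S.comap (frobenius K p)) :=
    isRegularLocalRing_of_frobenius p hB (mem_comap_frobenius_iff p S)
  have heq := toSubring_integralClosure_eq p (mem_comap_frobenius_iff p S) hKp hSn
  let e : S.comap (frobenius K p) ≃+* integralClosure S K :=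
    { toFun := fun x => ⟨x, by
        have hx : (x : K) ∈ (integralClosure S K).toSubring := by
          rw [heq]
          exact x.2
        exact hx⟩
      invFun := fun y => ⟨y, by
        have hy : (y : K) ∈ (integralClosure S K).toSubring := y.2
        rw [heq] at hy
        exact hy⟩
      left_inv := fun _ => rfl
      right_inv := fun _ => rfl
      map_mul' := fun _ _ => rfl
      map_add' := fun _ _ => rfl }
  exact IsRegularLocalRing.of_ringEquiv e

/-! ### Discharging «`K^p ⊆ Frac S`» when `K = (Frac S)(t)` with `t ^ p ∈ S` -/

variable (S) in
/-- If `t ^ p ∈ S` then every element of the ring `S[t] ⊆ K` has its `p`-th power in `S` (Frobenius is a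
ring homomorphism: `S[t] ≤ frobenius⁻¹(S)` because the generators are sent into `S`). [folklore] -/
theorem closure_insert_le_comap_frobenius {t : K} (ht : t ^ p ∈ S) :
    Subring.closure (insert t (S : Set K)) ≤ S.comap (frobenius K p) := by
  rw [Subring.closure_le]
  rintro x (rfl | hx)
  · exact (mem_comap_frobenius_iff p S x).mpr ht
  · exact (mem_comap_frobenius_iff p S x).mpr (S.pow_mem hx p)

variable (S) in
/-- «`K^p ⊆ Frac S`» from «`K = Frac (S[t])`, `t ^ p ∈ S`», elementary form: if every element of `K` is a
quotient of two elements of `S[t]`, then every `x ^ p` is a quotient of two elements of `S`. [folklore] -/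
theorem exists_div_pow_of_forall_exists_div {t : K} (ht : t ^ p ∈ S)
    (hK : ∀ x : K, ∃ u ∈ Subring.closure (insert t (S : Set K)),
      ∃ v ∈ Subring.closure (insert t (S : Set K)), x = u / v) (x : K) :
    ∃ a ∈ S, ∃ b ∈ S, b ≠ 0 ∧ x ^ p = a / b := by
  obtain ⟨u, hu, v, hv, rfl⟩ := hK x
  have hup : u ^ p ∈ S := (mem_comap_frobenius_iff p S u).mp (closure_insert_le_comap_frobenius p S ht hu)
  have hvp : v ^ p ∈ S := (mem_comap_frobenius_iff p S v).mp (closure_insert_le_comap_frobenius p S ht hv)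
  by_cases hv0 : v = 0
  · refine ⟨0, S.zero_mem, 1, S.one_mem, one_ne_zero, ?_⟩
    rw [hv0, div_zero, zero_pow (Fact.out : p.Prime).ne_zero, zero_div]
  · exact ⟨u ^ p, hup, v ^ p, hvp, pow_ne_zero p hv0, by rw [div_pow]⟩

variable (S) in
/-- «`K^p ⊆ Frac S`» in the LINE'S OWN SHAPE: `A₁ ⊆ S` a `k`-subalgebra of `K`, `t ^ p ∈ S`, and
`Frac (A₁[t]) = K` (`IsFractionRing (Algebra.adjoin k (insert t A₁)) K`, as in `CoreDatum` / `GenRebase`)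
give: every `x ^ p`, `x ∈ K`, is a quotient of two elements of `S`. [folklore] -/
theorem exists_div_pow_of_isFractionRing_adjoin {k : Type*} [Field k] [Algebra k K]
    (A₁ : Subalgebra k K) (hA₁ : (A₁ : Set K) ⊆ S) {t : K} (ht : t ^ p ∈ S)
    [IsFractionRing (Algebra.adjoin k (insert t (A₁ : Set K))) K] (x : K) :
    ∃ a ∈ S, ∃ b ∈ S, b ≠ 0 ∧ x ^ p = a / b := by
  -- `A₁[t] ⊆ S[t]` as subsets of `K`
  have hle : (Algebra.adjoin k (insert t (A₁ : Set K)) : Set K) ⊆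
      Subring.closure (insert t (S : Set K)) := by
    intro y hy
    induction hy using Algebra.adjoin_induction with
    | mem z hz =>
      rcases hz with rfl | hz
      · exact Subring.subset_closure (Set.mem_insert _ _)
      · exact Subring.subset_closure (Set.mem_insert_of_mem _ (hA₁ hz))
    | algebraMap r =>
      exact Subring.subset_closure (Set.mem_insert_of_mem _ (hA₁ (A₁.algebraMap_mem r)))
    | add y z _ _ hy hz => exact add_mem hy hz
    | mul y z _ _ hy hz => exact mul_mem hy hz
  refine exists_div_pow_of_forall_exists_div p S ht (fun y => ?_) x
  obtain ⟨a, b, -, hab⟩ := IsFractionRing.div_surjective (A := Algebra.adjoin k (insert t (A₁ : Set K))) y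
  exact ⟨a, hle a.2, b, hle b.2, hab.symm⟩

/-- **L4 `stub_sandwichModel` (the split's shape, `hSn` as a binder).** For `C := S.comap (frobenius K p)`
(`= {c | c ^ p ∈ S}`): `S ≤ C`; `C` is a regular local ring (as `B` is); Frobenius gives `C ≃+* B`;
and `C` is exactly the set of elements of `K` integral over `S`. [folklore] -/
theorem sandwichModel {B : Subring K} (hB : ∀ x, x ∈ B ↔ x ∈ S ∧ ∃ c : K, c ^ p = x)
    [IsRegularLocalRing B] (hKp : ∀ x : K, ∃ a ∈ S, ∃ b ∈ S, b ≠ 0 ∧ x ^ p = a / b)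
    (hSn : ∀ x : K, IsIntegral S x → (∃ a ∈ S, ∃ b ∈ S, b ≠ 0 ∧ x = a / b) → x ∈ S) :
    S ≤ S.comap (frobenius K p) ∧ IsRegularLocalRing (S.comap (frobenius K p)) ∧
      (∃ e : S.comap (frobenius K p) ≃+* B, ∀ c, ((e c : B) : K) = (c : K) ^ p) ∧
      ∀ c : K, c ∈ S.comap (frobenius K p) ↔ IsIntegral S c :=
  ⟨le_of_forall_mem_iff_pow_mem p (mem_comap_frobenius_iff p S),
    isRegularLocalRing_of_frobenius p hB (mem_comap_frobenius_iff p S),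
    exists_ringEquiv_frobenius p hB (mem_comap_frobenius_iff p S),
    mem_iff_isIntegral p (mem_comap_frobenius_iff p S) hKp hSn⟩

/-- **L4 `stub_sandwichModel`, `S` regular local.** The same with «`S` integrally closed in `Frac S`»
DISCHARGED from `[IsRegularLocalRing S]` (Matsumura Thm. 19.4, tree-proved), plus the regularity of
Mathlib's `integralClosure S K`. [cite: Matsumura1987, Thm. 19.4] -/
theorem sandwichModel_of_isRegularLocalRing [IsRegularLocalRing S] {B : Subring K}
    (hB : ∀ x, x ∈ B ↔ x ∈ S ∧ ∃ c : K, c ^ p = x) [IsRegularLocalRing B]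
    (hKp : ∀ x : K, ∃ a ∈ S, ∃ b ∈ S, b ≠ 0 ∧ x ^ p = a / b) :
    S ≤ S.comap (frobenius K p) ∧ IsRegularLocalRing (S.comap (frobenius K p)) ∧
      (∃ e : S.comap (frobenius K p) ≃+* B, ∀ c, ((e c : B) : K) = (c : K) ^ p) ∧
      (∀ c : K, c ∈ S.comap (frobenius K p) ↔ IsIntegral S c) ∧
      IsRegularLocalRing (integralClosure S K) :=
  have hSn : ∀ x : K, IsIntegral S x → (∃ a ∈ S, ∃ b ∈ S, b ≠ 0 ∧ x = a / b) → x ∈ S :=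
    fun _ hx hfr => mem_of_isIntegral_of_exists_div_of_isRegularLocalRing S hx hfr
  ⟨(sandwichModel p hB hKp hSn).1, (sandwichModel p hB hKp hSn).2.1, (sandwichModel p hB hKp hSn).2.2.1,
    (sandwichModel p hB hKp hSn).2.2.2, isRegularLocalRing_integralClosure p hB hKp hSn⟩

/-- **L4 `stub_sandwichModel`, line shape.** `S` a regular local subring of `K` containing the
`k`-subalgebra `A₁`, `t ^ p ∈ S`, `Frac (A₁[t]) = K`, and `B = S ∩ K^p` regular local (object-free `hB`):
then `C := frobenius⁻¹(S) = {c | c ^ p ∈ S} ⊇ S` is a regular local ring, Frobenius-isomorphic to `B`,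
equal to the set of `S`-integral elements of `K`, and Mathlib's `integralClosure S K` is a regular local
ring. Both auxiliary hypotheses of `sandwichModel` are discharged here. [cite: Matsumura1987, Thm. 19.4]
[folklore] -/
theorem sandwichModel_of_isFractionRing_adjoin {k : Type*} [Field k] [Algebra k K] [IsRegularLocalRing S]
    (A₁ : Subalgebra k K) (hA₁ : (A₁ : Set K) ⊆ S) {t : K} (ht : t ^ p ∈ S)
    [IsFractionRing (Algebra.adjoin k (insert t (A₁ : Set K))) K] {B : Subring K}
    (hB : ∀ x, x ∈ B ↔ x ∈ S ∧ ∃ c : K, c ^ p = x) [IsRegularLocalRing B] :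
    S ≤ S.comap (frobenius K p) ∧ IsRegularLocalRing (S.comap (frobenius K p)) ∧
      (∃ e : S.comap (frobenius K p) ≃+* B, ∀ c, ((e c : B) : K) = (c : K) ^ p) ∧
      (∀ c : K, c ∈ S.comap (frobenius K p) ↔ IsIntegral S c) ∧
      IsRegularLocalRing (integralClosure S K) :=
  sandwichModel_of_isRegularLocalRing p hB (exists_div_pow_of_isFractionRing_adjoin p S A₁ hA₁ ht)

end Sandwich

end Sandwich

end Summit.ResolutionOfSingularities.ResolutionOfSingularities.Theorems.SwitchingDichotomy

end
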